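import Summits.QuantumFields.BalabanUV.T4Continuum.Support.NE9TorusIneq126Chain

/-!
# NE9TorusIneq126ChainSum — [II] (1.26) on the cell's TORUS model, DIRECTLY from the block chain: threshold `κ₁ = 4·log Γ`,
# `Γ = 2^(2^d)·(3^d+1)²` (d = 4: `79 < κ₁ < 80`), socket constant `2^{d+1}·Γ³` (d = 4: `< 2.74·10²⁷`) — in place of the volume-leaf route's
# `κ₀(64,8) = 64·log 162 ≈ 325.6`, `K₀(64,8) = 162⁶⁴/81 ∈ (10¹³⁹, 10¹⁴⁰)` (cell `pub-balaban`, T4-DAG §2 node U3 / §6 rows NE9 ∕ NE5; NE9 formalisation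
# swarm LEAF PROVER 05, lineage leaf-05, generation 4; part B2 of the lineage item — part A `NE9TreeBlockChain` p212919, part B1 `NE9TorusIneq126Chain`)

HONEST FRAMING (T4-DAG PAGE 1).  Rung (B)+1 of the FINITE-VOLUME T⁴ programme — existence AND uniqueness of the ε → 0 limit of
gauge-invariant observables on a fixed torus; NOT infinite volume, NOT a mass gap, NOT the Clay problem.  NE9 (`T4OutputRate.NE9` ∧
`FadingMemory`) is a cell NEW ESTIMATE, NOT PRINTED, and is NOT discharged here («NE9 ⇐ the named binders»); spine 0/9 unchanged; 0/18
leaves instantiated on Bałaban's objects.  HONEST DEPENDENCY (cell line, verbatim): continuum YM on T⁴ ⇐ BetaPertH ∧ nine spine estimates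
(0/9 proved); BetaPertH ⇐ (D1) ∧ (D4) ∧ CAP+tail; G-an2-4 gates asym, D1 and NE2/3/4.  `FlowStep.BetaPertH`, (B), (B^μ) do not occur here.
[II] = [Balaban1988RG2Cluster] is quoted for TYPES only (ABSOLUTE RULE: nothing printed in the audited series is asserted).  (1.26) is PRINTED
*"for κ sufficiently large"* with an unspecified O(1); what this file changes is the CELL's certified threshold and constant on its model of
`d_j` (`TreeLengthTorus.torusTreeLen`, reading D-pv22g2.1, sup-metric convention D-pv22.1 (i): the printed Euclidean length satisfies
`d_eucl ≥ d_sup`, so an upper bound for `Σ e^{−κ·d_sup}` bounds the Euclidean sum — stated, not used).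

THE LOCATED POINT (FINDING F-ne9leaf05g3-1, census class): see part B1.  The part-1 sibling `NE9TorusSizeDichotomy.ineq126_above` keeps the
volume-leaf threshold `64·log 162` and makes the constant `2²⁰ + K₀(64,8)e^{−(κ−κ₀)}`, which is `≤ 2²⁰ + 1` only from `κ ≈ 647`.  THIS FILE
(kernel, no new definition, no `def … : Prop`, 0 sorry; part B1's constants `chainConst`, `kappa₁` BY NAME):
* §3 **the shell sum** `sum_filter_ne_zero_le_chain`: for `κ > κ₁`, `Σ_{Ȳ ∈ S, Ȳ ∋ c̄, d_j ≠ 0} e^{−κ d_j(Ȳ)} ≤ 2^d·Γ³·q/(1−q)`, `q = e^{−(κ−κ₁)}`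
  (torus dichotomy `NE9TorusSizeDichotomy.torusTreeLen_dichotomy`: the shell `⌊d_j⌋ = m ≥ 1` has `≤ 2^d·Γ^{4m+3}` members by part B1 and weight
  `≤ e^{−κm}`; geometric sum `geom_sum_Ico_le_of_lt_one`); `tail_factor_le`: `q/(1−q) ≤ 2q` from `κ ≥ κ₁ + 1`;
* §4 **the socket** `ineq126_chain`: `Ineq126 S (·) torusTreeLen κ (2^d·2^(2^d) + 2^{d+1}·Γ³·e^{−(κ−κ₁)})` for `κ ≥ κ₁ + 1` — the SAME shape as
  part 1's `ineq126_above` with `(κ₁, 2^{d+1}Γ³)` for `(κ₀(64,8), K₀(64,8))` (sharp form `ineq126_chain_sharp` with `q/(1−q)` for `κ > κ₁`;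
  remark form `sum_filter_ne_zero_le_chain_exp`);
* §5 numerals (d = 4; kernel `norm_num` on Mathlib's `Real.exp_one_gt_d9`/`Real.exp_one_lt_d9`; two local engines — exact rationals with a
  factorial-series enclosure of `e`, and 60-digit decimals — agree line by line, `HOME/t4/b2b-balaban-t4-ne9-formalise-leaf-05/g4/census/`):
  **`79 < κ₁(4) < 80`**, `2⁵·Γ_4³ < 2.74·10²⁷` (exactly `2 738 248 664 286 542 429 167 812 608`), `2⁵·Γ_4³ < e⁶⁴`, hence **`ineq126_chain_four`**:
  for `κ ≥ 144` the `d_j ≠ 0` tail through any cube is `≤ 1` and `Σ_{Ȳ ∋ c̄} e^{−κ d_j(Ȳ)} ≤ 2²⁰ + 1` on the torus model of `(ℤ/N)⁴` — versus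
  `κ ≥ κ₀ + log K₀ ≈ 647` on the volume-leaf route.
DISGUISE TEST: real arithmetic over part B1's count and part 1's dichotomy; no activity, no history — not NE9, not NE5.

References (TYPES only): T. Bałaban, *Renormalization group approach to lattice gauge field theories. II. Cluster expansions*, Commun.
Math. Phys. **116**, 1–22 (1988) [Balaban1988RG2Cluster], (1.26) p. 8 with the remark l. 11–13 (render
`b2b-balaban-ref1/pages/1988-cmp116-rg-II-cluster/1988-cmp116-rg-II-cluster-p008-x2.png`).  Summits-side NEW work (LEAN PLACEMENT RULE); imports
part B1 only; modifies nothing.  Value = a certified threshold/constant of the cell's census brought from `(325.6, 10^{139.5})` to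
`(79.6, 10^{27.4})` by a theorem of the cell's geometry, NOT summit progress.
-/

noncomputable section

open scoped BigOperators

namespace Summit.QuantumFields.BalabanUV.T4Continuum.NE9TorusIneq126ChainSum

open Literature.MathematicalPhysics.QuantumFieldTheory.Balaban1983to89
open Literature.MathematicalPhysics.QuantumFieldTheory.Balaban1983to89.TreeLength
open Literature.MathematicalPhysics.QuantumFieldTheory.Balaban1983to89.TreeLengthTorus
open Literature.MathematicalPhysics.QuantumFieldTheory.Balaban1983to89.B13FamilySum (Ineq126)
open Summit.QuantumFields.BalabanUV.T4Continuum.NE9TorusSizeDichotomy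
  (torusTreeLen_dichotomy card_filter_torusTreeLen_eq_zero_le)
open Summit.QuantumFields.BalabanUV.T4Continuum.NE9TorusIneq126Chain

variable {d N : ℕ}


/-! ## §3 The shell sum: (1.26) over the domains with `d_j ≠ 0`, above the block-chain threshold -/

/-- **THE `d_j ≠ 0` TAIL OF (1.26), BLOCK-CHAIN FORM** — print's remark after (1.26), [Balaban1988RG2Cluster] p. 8 l. 11–13, verbatim:
*"for κ sufficiently large. The number O(1) is in fact small, because we sum over X with d_j(X) ≠ 0"* (quoted as a TYPE; what is proved is
about the cell's model): over any catalogue `S` of torus localization domains, for every cube `c̄` and every `κ > κ₁(d) = 4·log Γ_d`,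
`Σ_{Ȳ ∈ S, Ȳ ∋ c̄, d_j(Ȳ) ≠ 0} e^{−κ d_j(Ȳ)} ≤ 2^d·Γ³·q/(1 − q)`, `q := e^{−(κ−κ₁)}` (shells `⌊d_j⌋ = m ≥ 1` by the torus dichotomy, §2 on each).
[cite: Balaban1988RG2Cluster, (1.26) p.8] -/
theorem sum_filter_ne_zero_le_chain [NeZero N] (S : Finset (Finset (TPt d N)))
    (hS : ∀ Y ∈ S, Y.Nonempty ∧ TFaceConnected Y) (c : TPt d N) {κ : ℝ} (hκ : kappa₁ d < κ) :
    ∑ Y ∈ (S.filter fun Y => c ∈ Y).filter (fun Y => torusTreeLen Y ≠ 0), Real.exp (-(κ * torusTreeLen Y))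
      ≤ 2 ^ d * chainConst d ^ 3 *
        (Real.exp (-(κ - kappa₁ d)) / (1 - Real.exp (-(κ - kappa₁ d)))) := by
  classical
  set F := (S.filter fun Y => c ∈ Y).filter (fun Y => torusTreeLen Y ≠ 0) with hF
  set q := Real.exp (-(κ - kappa₁ d)) with hq
  have hq0 : 0 < q := Real.exp_pos _
  have hq1 : q < 1 := by
    rw [hq, Real.exp_lt_one_iff]
    linarith
  have hκ0 : 0 < κ := (kappa₁_pos d).trans hκ
  have hΓ := chainConst_pos d
  let fl : Finset (TPt d N) → ℕ := fun Y => ⌊torusTreeLen Y⌋₊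
  -- each term is at most `e^{−κ⌊d_j⌋}`
  have hterm : ∀ Y ∈ F, Real.exp (-(κ * torusTreeLen Y)) ≤ Real.exp (-(κ * (fl Y : ℝ))) := by
    intro Y _
    apply Real.exp_le_exp.2
    have := Nat.floor_le (torusTreeLen_nonneg Y)
    nlinarith
  -- on `F` the shells start at `m = 1` (torus dichotomy)
  have hfl1 : ∀ Y ∈ F, 1 ≤ fl Y := by
    intro Y hY
    have hY' := (Finset.mem_filter.1 hY).2
    rcases torusTreeLen_dichotomy Y with h0 | h1
    · exact absurd h0 hY'
    · exact Nat.le_floor (by exact_mod_cast h1)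
  -- the shell `⌊d_j⌋ = m` has at most `2^d Γ^{4m+3}` members
  have hshell : ∀ m : ℕ, ((F.filter fun Y => fl Y = m).card : ℝ) ≤ 2 ^ d * chainConst d ^ (4 * m + 3) := by
    intro m
    have hsub : (F.filter fun Y => fl Y = m) ⊆ S.filter fun Y => c ∈ Y ∧ torusTreeLen Y < ((m + 1 : ℕ) : ℝ) := by
      intro Y hY
      obtain ⟨hYF, hYm⟩ := Finset.mem_filter.1 hY
      obtain ⟨hY1, -⟩ := Finset.mem_filter.1 hYF
      obtain ⟨hYS, hcY⟩ := Finset.mem_filter.1 hY1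
      refine Finset.mem_filter.2 ⟨hYS, hcY, ?_⟩
      have h := Nat.lt_floor_add_one (torusTreeLen Y)
      rw [show ⌊torusTreeLen Y⌋₊ = m from hYm] at h
      exact_mod_cast h
    have h1 := card_filter_torusTreeLen_lt_le_pow S hS c (n := m + 1) (by omega)
    rw [show 4 * (m + 1) - 1 = 4 * m + 3 by omega] at h1
    calc ((F.filter fun Y => fl Y = m).card : ℝ)
        ≤ ((S.filter fun Y => c ∈ Y ∧ torusTreeLen Y < ((m + 1 : ℕ) : ℝ)).card : ℝ) := by
          exact_mod_cast Finset.card_le_card hsub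
      _ ≤ 2 ^ d * chainConst d ^ (4 * m + 3) := h1
  -- the shells are indexed by a subset of `[1, Mx]`
  set I := F.image fl with hI
  set Mx := I.sup id with hMx
  have hIsub : I ⊆ Finset.Ico 1 (Mx + 1) := by
    intro m hm
    rw [Finset.mem_Ico]
    obtain ⟨Y, hY, rfl⟩ := Finset.mem_image.1 hm
    exact ⟨hfl1 Y hY, Nat.lt_succ_of_le (Finset.le_sup (f := id) hm)⟩
  calc ∑ Y ∈ F, Real.exp (-(κ * torusTreeLen Y))
      ≤ ∑ Y ∈ F, Real.exp (-(κ * (fl Y : ℝ))) := Finset.sum_le_sum hterm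
    _ = ∑ m ∈ I, ((F.filter fun Y => fl Y = m).card : ℝ) * Real.exp (-(κ * (m : ℝ))) := by
        rw [hI, Finset.sum_comp (fun m : ℕ => Real.exp (-(κ * (m : ℝ)))) fl]
        refine Finset.sum_congr rfl fun m _ => ?_
        rw [nsmul_eq_mul]
    _ ≤ ∑ m ∈ I, 2 ^ d * chainConst d ^ (4 * m + 3) * Real.exp (-(κ * (m : ℝ))) :=
        Finset.sum_le_sum fun m _ => mul_le_mul_of_nonneg_right (hshell m) (Real.exp_pos _).le
    _ = 2 ^ d * chainConst d ^ 3 * ∑ m ∈ I, q ^ m := by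
        rw [Finset.mul_sum]
        refine Finset.sum_congr rfl fun m _ => ?_
        rw [hq, ← exp_neg_mul_mul_pow d κ m]
        ring
    _ ≤ 2 ^ d * chainConst d ^ 3 * (q / (1 - q)) := by
        refine mul_le_mul_of_nonneg_left ?_ (by positivity)
        calc ∑ m ∈ I, q ^ m ≤ ∑ m ∈ Finset.Ico 1 (Mx + 1), q ^ m :=
              Finset.sum_le_sum_of_subset_of_nonneg hIsub fun m _ _ => pow_nonneg hq0.le m
          _ ≤ q ^ 1 / (1 - q) := geom_sum_Ico_le_of_lt_one hq0.le hq1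
          _ = q / (1 - q) := by rw [pow_one]

/-- Above `κ₁ + 1` the geometric factor is at most `2q`: `q/(1−q) ≤ 2·e^{−(κ−κ₁)}`. [folklore] -/
theorem tail_factor_le (d : ℕ) {κ : ℝ} (hκ : kappa₁ d + 1 ≤ κ) :
    Real.exp (-(κ - kappa₁ d)) / (1 - Real.exp (-(κ - kappa₁ d))) ≤ 2 * Real.exp (-(κ - kappa₁ d)) := by
  set q := Real.exp (-(κ - kappa₁ d)) with hq
  have hq0 : 0 < q := Real.exp_pos _
  have hqhalf : q ≤ 1 / 2 := by
    have h1 : q ≤ Real.exp (-1) := Real.exp_le_exp.2 (by linarith)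
    have h2 : Real.exp (-1) ≤ 1 / 2 := by
      rw [Real.exp_neg, inv_eq_one_div]
      exact one_div_le_one_div_of_le (by norm_num) (by linarith [Real.exp_one_gt_d9])
    exact h1.trans h2
  rw [div_le_iff₀ (by linarith)]
  nlinarith

/-! ## §4 The socket: (1.26) above the block-chain threshold in the shape of part 1's `ineq126_above` -/

/-- **[II] (1.26) ON THE TORUS MODEL, BLOCK-CHAIN FORM** ([Balaban1988RG2Cluster] p. 8, verbatim: *"Σ_{X∈𝐃_j, X⊃□′} exp(−κd_j(X)) ≤ O(1),
(1.26) for κ sufficiently large"* — quoted as a TYPE): over any catalogue `S` of torus localization domains, for every `κ > κ₁(d)`,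
`Ineq126 S (·) d_j κ (2^d·2^(2^d) + 2^d·Γ³·q/(1−q))`, `q = e^{−(κ−κ₁)}` — the `d_j = 0` class through a cube (`≤ 2^d·2^(2^d)` members, part 1
`card_filter_torusTreeLen_eq_zero_le`) plus the §3 tail. [cite: Balaban1988RG2Cluster, (1.26) p.8] -/
theorem ineq126_chain_sharp [NeZero N] (S : Finset (Finset (TPt d N))) (hS : ∀ Y ∈ S, Y.Nonempty ∧ TFaceConnected Y)
    {κ : ℝ} (hκ : kappa₁ d < κ) :
    Ineq126 S (fun Y => Y) torusTreeLen κ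
      (2 ^ d * 2 ^ (2 ^ d) + 2 ^ d * chainConst d ^ 3 *
        (Real.exp (-(κ - kappa₁ d)) / (1 - Real.exp (-(κ - kappa₁ d))))) := by
  classical
  intro c
  rw [← Finset.sum_filter_add_sum_filter_not (S.filter fun Y => c ∈ Y) (fun Y => torusTreeLen Y = 0)]
  refine add_le_add ?_ (sum_filter_ne_zero_le_chain S hS c hκ)
  have hz : ∑ Y ∈ (S.filter fun Y => c ∈ Y).filter (fun Y => torusTreeLen Y = 0), Real.exp (-(κ * torusTreeLen Y))
      = (((S.filter fun Y => c ∈ Y).filter fun Y => torusTreeLen Y = 0).card : ℝ) := by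
    rw [Finset.card_eq_sum_ones, Nat.cast_sum, Nat.cast_one]
    refine Finset.sum_congr rfl fun Y hY => ?_
    rw [(Finset.mem_filter.1 hY).2, mul_zero, neg_zero, Real.exp_zero]
  rw [hz, Finset.filter_filter]
  exact_mod_cast card_filter_torusTreeLen_eq_zero_le S hS c

/-- **THE SOCKET** (same shape as part 1's `ineq126_above`, constants `(κ₁, 2^{d+1}Γ³)` for `(κ₀(64,8), K₀(64,8))`): over any catalogue `S` of
torus localization domains, for every `κ ≥ κ₁(d) + 1`, `Ineq126 S (·) d_j κ (2^d·2^(2^d) + 2^{d+1}·Γ_d³·e^{−(κ−κ₁(d))})`.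
[cite: Balaban1988RG2Cluster, (1.26) p.8] -/
theorem ineq126_chain [NeZero N] (S : Finset (Finset (TPt d N))) (hS : ∀ Y ∈ S, Y.Nonempty ∧ TFaceConnected Y)
    {κ : ℝ} (hκ : kappa₁ d + 1 ≤ κ) :
    Ineq126 S (fun Y => Y) torusTreeLen κ
      (2 ^ d * 2 ^ (2 ^ d) + 2 ^ (d + 1) * chainConst d ^ 3 * Real.exp (-(κ - kappa₁ d))) := by
  intro c
  refine (ineq126_chain_sharp S hS (by linarith) c).trans ?_
  have h := tail_factor_le d hκ
  have hΓ : (0 : ℝ) ≤ 2 ^ d * chainConst d ^ 3 := by have := chainConst_pos d; positivity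
  calc (2 : ℝ) ^ d * 2 ^ (2 ^ d) + 2 ^ d * chainConst d ^ 3 *
        (Real.exp (-(κ - kappa₁ d)) / (1 - Real.exp (-(κ - kappa₁ d))))
      ≤ 2 ^ d * 2 ^ (2 ^ d) + 2 ^ d * chainConst d ^ 3 * (2 * Real.exp (-(κ - kappa₁ d))) := by
        gcongr
    _ = 2 ^ d * 2 ^ (2 ^ d) + 2 ^ (d + 1) * chainConst d ^ 3 * Real.exp (-(κ - kappa₁ d)) := by ring

/-- The remark's quantitative form at the socket's threshold: for `κ ≥ κ₁ + 1` the `d_j ≠ 0` part of the (1.26)-sum through any cube is at most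
`2^{d+1}·Γ³·e^{−(κ−κ₁)}` — exponentially small above the block-chain threshold. [cite: Balaban1988RG2Cluster, (1.26) p.8] -/
theorem sum_filter_ne_zero_le_chain_exp [NeZero N] (S : Finset (Finset (TPt d N)))
    (hS : ∀ Y ∈ S, Y.Nonempty ∧ TFaceConnected Y) (c : TPt d N) {κ : ℝ} (hκ : kappa₁ d + 1 ≤ κ) :
    ∑ Y ∈ (S.filter fun Y => c ∈ Y).filter (fun Y => torusTreeLen Y ≠ 0), Real.exp (-(κ * torusTreeLen Y))
      ≤ 2 ^ (d + 1) * chainConst d ^ 3 * Real.exp (-(κ - kappa₁ d)) := by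
  refine (sum_filter_ne_zero_le_chain S hS c (by linarith)).trans ?_
  have h := tail_factor_le d hκ
  have hΓ : (0 : ℝ) ≤ 2 ^ d * chainConst d ^ 3 := by have := chainConst_pos d; positivity
  calc (2 : ℝ) ^ d * chainConst d ^ 3 * (Real.exp (-(κ - kappa₁ d)) / (1 - Real.exp (-(κ - kappa₁ d))))
      ≤ 2 ^ d * chainConst d ^ 3 * (2 * Real.exp (-(κ - kappa₁ d))) := mul_le_mul_of_nonneg_left h hΓ
    _ = 2 ^ (d + 1) * chainConst d ^ 3 * Real.exp (-(κ - kappa₁ d)) := by ring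

/-! ## §5 The numerals for `d = 4` -/

/-- `κ₁(4) < 80` (`Γ_4⁴ < e⁸⁰`, from `2.7182818283 < e`). [folklore] -/
theorem kappa₁_four_lt : kappa₁ 4 < 80 := by
  unfold kappa₁
  rw [chainConst_four]
  have he := Real.exp_one_gt_d9
  have h1 : Real.log 440664064 < 20 := by
    rw [Real.log_lt_iff_lt_exp (by norm_num)]
    calc (440664064 : ℝ) < (2.7182818283 : ℝ) ^ 20 := by norm_num
      _ ≤ Real.exp 1 ^ 20 := pow_le_pow_left₀ (by norm_num) he.le 20
      _ = Real.exp 20 := by rw [← Real.exp_nat_mul]; norm_num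
  linarith

/-- `79 < κ₁(4)` (`e⁷⁹ < Γ_4⁴`, from `e < 2.7182818286`). [folklore] -/
theorem kappa₁_four_gt : 79 < kappa₁ 4 := by
  unfold kappa₁
  rw [chainConst_four]
  have he := Real.exp_one_lt_d9
  have h1 : (79 : ℝ) / 4 < Real.log 440664064 := by
    rw [Real.lt_log_iff_exp_lt (by norm_num)]
    have h4 : Real.exp (79 / 4) ^ 4 < (440664064 : ℝ) ^ 4 :=
      calc Real.exp (79 / 4) ^ 4 = Real.exp 1 ^ 79 := by
            rw [← Real.exp_nat_mul, ← Real.exp_nat_mul]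
            norm_num
        _ < (2.7182818286 : ℝ) ^ 79 := pow_lt_pow_left₀ he (Real.exp_pos 1).le (by norm_num)
        _ < (440664064 : ℝ) ^ 4 := by norm_num
    exact lt_of_pow_lt_pow_left₀ 4 (by norm_num) h4
  linarith

/-- The socket constant `2⁵·Γ_4³ < 2.74·10²⁷` (exactly `2 738 248 664 286 542 429 167 812 608`; versus `K₀(64,8) > 10¹³⁹`). [folklore] -/
theorem socketConst_four_lt : (2 : ℝ) ^ (4 + 1) * chainConst 4 ^ 3 < 2.74e27 := by
  rw [chainConst_four]
  norm_num

/-- `2⁵·Γ_4³ < e⁶⁴`: hence for `κ ≥ κ₁(4) + 64` (in particular for `κ ≥ 144`) the `d_j ≠ 0` tail of (1.26) through any cube is `≤ 1` on the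
torus model (§4), versus `κ ≥ κ₀ + log K₀ ≈ 647` on the volume-leaf route. [folklore] -/
theorem socketConst_four_lt_exp : (2 : ℝ) ^ (4 + 1) * chainConst 4 ^ 3 < Real.exp 64 := by
  rw [chainConst_four]
  have he := Real.exp_one_gt_d9
  calc (2 : ℝ) ^ (4 + 1) * 440664064 ^ 3 < (2.7182818283 : ℝ) ^ 64 := by norm_num
    _ ≤ Real.exp 1 ^ 64 := pow_le_pow_left₀ (by norm_num) he.le 64
    _ = Real.exp 64 := by rw [← Real.exp_nat_mul]; norm_num

/-- **THE `d = 4` CORNER**: over any catalogue of torus localization domains of `(ℤ/N)⁴`, for every `κ ≥ 144` and every cube `c̄`, the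
`d_j ≠ 0` part of the (1.26)-sum is `≤ 1`, hence `Σ_{Ȳ ∋ c̄} e^{−κ d_j(Ȳ)} ≤ 2²⁰ + 1`. [cite: Balaban1988RG2Cluster, (1.26) p.8] -/
theorem ineq126_chain_four [NeZero N] (S : Finset (Finset (TPt 4 N))) (hS : ∀ Y ∈ S, Y.Nonempty ∧ TFaceConnected Y)
    {κ : ℝ} (hκ : 144 ≤ κ) : Ineq126 S (fun Y => Y) torusTreeLen κ (2 ^ 20 + 1) := by
  have hk := kappa₁_four_lt
  intro c
  refine (ineq126_chain S hS (by linarith) c).trans ?_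
  have htail : (2 : ℝ) ^ (4 + 1) * chainConst 4 ^ 3 * Real.exp (-(κ - kappa₁ 4)) ≤ 1 := by
    have h1 : Real.exp (-(κ - kappa₁ 4)) ≤ Real.exp (-64) := Real.exp_le_exp.2 (by linarith)
    have h2 := socketConst_four_lt_exp
    have h3 : (0 : ℝ) ≤ 2 ^ (4 + 1) * chainConst 4 ^ 3 := by have := chainConst_pos 4; positivity
    calc (2 : ℝ) ^ (4 + 1) * chainConst 4 ^ 3 * Real.exp (-(κ - kappa₁ 4))
        ≤ 2 ^ (4 + 1) * chainConst 4 ^ 3 * Real.exp (-64) := mul_le_mul_of_nonneg_left h1 h3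
      _ ≤ Real.exp 64 * Real.exp (-64) := mul_le_mul_of_nonneg_right h2.le (Real.exp_pos _).le
      _ = 1 := by rw [← Real.exp_add]; norm_num
  have h20 : (2 : ℝ) ^ 4 * 2 ^ (2 ^ 4) = 2 ^ 20 := by norm_num
  rw [h20]
  linarith

end Summit.QuantumFields.BalabanUV.T4Continuum.NE9TorusIneq126ChainSum

end
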